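import Literature.Computability.Cryptography.InaccessibleEntropyUOWHFFamily
import HarnessLib

/-!
# One-way functions ⇒ UOWHF, machine layer VI: bricks of the inverting machine (coin parsing, key fix-up, partial chains)

Topic `Literature/Computability/Cryptography`; fourteenth file of the "one-way functions ⇒ universal one-way
hash functions" line (Haitner–Holenstein–Reingold–Vadhan–Wee 2020, proof of Thm. 5.1). The security reduction
turns a designated-collision finder `(A₀, A)` for the family of `InaccessibleEntropyUOWHFFamily.lean` into an
inverter for `f` (Claim 4.6 composed with Lemmas 5.3–5.7 and the two planting steps). The inverter is ONE
probabilistic polynomial-time machine; this file supplies its parts as total string functions with matching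
`FP` bricks on the record `⟨⟨1ⁿ, y⟩, coins⟩`:

* `sumF`, `fldF` — reading consecutive fixed-length fields of the coin string (lengths given by bricks),
  `fldF_W` (value), `fldF_mem_FP`;
* the **key fix-up** of the inverter of Claim 4.6 (sampling the hash key uniformly among the keys that plant
  `y` next to `f x` on the first `i` rows): `lzStr`, `rowStr`, `fixRow`, `fixupStr` and the brick `fixupP`
  (`fixupP_apply`, `fixupP_mem_FP`): row `q < i` of the affine key is made orthogonal to `δ = y ⊕ f x` by
  flipping its bit at the pivot of `δ`;
* `splice` (replace a block; `splice_block`, `BitCodec.pi_enc_update`: splicing a code is `Function.update`)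
  and its brick `spliceP`; the **partial chain** brick `chainUptoP f` computing the
  level-`r` chain state `chainSt f n j kb x r` for a level `r ≤ R` read from the record (`chainUptoP_apply`,
  `chainUptoP_mem_FP`), re-using the loop body of `InaccessibleEntropyUOWHFFamily.lean`.

All statements proved; no named facts. The assembly of the inverter and its analysis follow.

## References

* I. Haitner, T. Holenstein, O. Reingold, S. Vadhan, H. Wee, *Inaccessible Entropy II: IE Functions and
  Universal One-Way Hashing*, Theory of Computing 16(8) (2020), Claim 4.6 (the inverter `Inv`: "choose `g`
  uniformly subject to `g(y)_{1…i} = g(f(x))_{1…i}`"), Lemmas 5.3–5.7.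
* O. Goldreich, *Foundations of Cryptography II*, CUP 2004, §6.4.3.2 (proof of Prop. 6.4.21: the same
  conditioning of the hash on the challenge).
-/

namespace Literature.Computability.Cryptography

namespace HHRVW

open _root_.Computability Complexity Complexity.Brick Complexity.Plumb Complexity.UExpr Complexity.BitCodec AffineStr Sz
open Literature.Computability.Learning (xorStrFn xorStrFn_apply xorStrFn_mem_FP)

/-! ### Reading fields of the coin string -/

section Fields

/-- The record of the inverter: `⟨⟨1ⁿ, y⟩, c⟩`. [folklore] -/
def Wrec (n : ℕ) (y c : List Bool) : List Bool := boolPair (boolPair (ones n) y) c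

/-- `1ⁿ` from the record. [folklore] -/
noncomputable def WnF : List Bool → List Bool := fstF ∘ fstF
/-- `y` from the record. [folklore] -/
noncomputable def WyF : List Bool → List Bool := sndF ∘ fstF
/-- the coins from the record. [folklore] -/
noncomputable def WcF : List Bool → List Bool := sndF
/-- A size `e(n)` in unary from the record. [folklore] -/
noncomputable def WszF (e : UExpr) : List Bool → List Bool := szF e ∘ fanoutFn WnF fun _ => []
/-- A polynomial size `Q(n)` in unary from the record. [folklore] -/
noncomputable def WpolyF (Q : Polynomial ℕ) : List Bool → List Bool := polyFn Q ∘ WnF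

variable (n : ℕ) (y c : List Bool)

/-- Bookkeeping lemma (record accessors). [folklore] -/
@[simp] theorem WnF_W : WnF (Wrec n y c) = ones n := by simp [WnF, Wrec]
/-- Bookkeeping lemma (record accessors). [folklore] -/
@[simp] theorem WyF_W : WyF (Wrec n y c) = y := by simp [WyF, Wrec]
/-- Bookkeeping lemma (record accessors). [folklore] -/
@[simp] theorem WcF_W : WcF (Wrec n y c) = c := by simp [WcF, Wrec]
/-- Bookkeeping lemma (record accessors). [folklore] -/
@[simp] theorem WszF_W (e : UExpr) : WszF e (Wrec n y c) = ones (e.eval fun i => if i = 0 then n else (nthF 0 ([] : List Bool)).length) := by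
  rw [WszF, Function.comp_apply, fanoutFn_apply, WnF_W, szF_boolPair]
/-- Bookkeeping lemma (record accessors). [folklore] -/
@[simp] theorem WpolyF_W (Q : Polynomial ℕ) : WpolyF Q (Wrec n y c) = ones (Q.eval n) := by
  simp [WpolyF, ones]

/-- Bookkeeping lemma (record accessors). [folklore] -/
theorem WnF_mem_FP : WnF ∈ FP := comp_mem_FP fstF_mem_FP fstF_mem_FP
/-- Bookkeeping lemma (record accessors). [folklore] -/
theorem WyF_mem_FP : WyF ∈ FP := comp_mem_FP sndF_mem_FP fstF_mem_FP
/-- Bookkeeping lemma (record accessors). [folklore] -/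
theorem WcF_mem_FP : WcF ∈ FP := sndF_mem_FP
/-- Bookkeeping lemma (record accessors). [folklore] -/
theorem WszF_mem_FP (e : UExpr) : WszF e ∈ FP := comp_mem_FP (szF_mem_FP e) (fanoutFn_mem_FP WnF_mem_FP (const_mem_FP _))
/-- Bookkeeping lemma (record accessors). [folklore] -/
theorem WpolyF_mem_FP (Q : Polynomial ℕ) : WpolyF Q ∈ FP := comp_mem_FP (polyFn_mem_FP Q) WnF_mem_FP

/-- The concatenation of the values of a list of bricks (a running offset in unary). [folklore] -/
noncomputable def sumF : List (List Bool → List Bool) → List Bool → List Bool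
  | [] => fun _ => []
  | g :: gs => catF g (sumF gs)

/-- `sumF` of unary-valued bricks is the unary sum. [folklore] -/
theorem sumF_apply_ones {w : List Bool} : ∀ {gs : List (List Bool → List Bool)} {ls : List ℕ},
    List.Forall₂ (fun g l => g w = ones l) gs ls → sumF gs w = ones ls.sum
  | [], [], _ => rfl
  | g :: gs, l :: ls, h => by
    cases h with
    | cons h1 h2 => rw [sumF, catF_apply, h1, sumF_apply_ones h2, List.sum_cons]; simp [ones]

/-- `sumF gs ∈ FP` for bricks in `FP`. [folklore] -/
theorem sumF_mem_FP : ∀ {gs : List (List Bool → List Bool)}, (∀ g ∈ gs, g ∈ FP) → sumF gs ∈ FP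
  | [], _ => const_mem_FP _
  | g :: gs, h => catF_mem_FP (h g (by simp)) (sumF_mem_FP fun g' hg' => h g' (by simp [hg']))

/-- **Field `k`** of the coins, for a list of length bricks: `(c ⇂ off_k) ↾ len_k`. [folklore] -/
noncomputable def fldF (gs : List (List Bool → List Bool)) (k : ℕ) : List Bool → List Bool :=
  takeFn ∘ fanoutFn (gs.getD k fun _ => []) (dropFn ∘ fanoutFn (sumF (gs.take k)) WcF)

/-- The remainder of the coins after all fields. [folklore] -/
noncomputable def restF (gs : List (List Bool → List Bool)) : List Bool → List Bool := dropFn ∘ fanoutFn (sumF gs) WcF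

/-- A field of a string: `(c ⇂ off) ↾ len`. [folklore] -/
def fld (c : List Bool) (off len : ℕ) : List Bool := (c.drop off).take len

/-- **Value of a field brick** when the length bricks evaluate to `1^{lᵢ}` on the record. [folklore] -/
theorem fldF_W {gs : List (List Bool → List Bool)} {ls : List ℕ} (h : List.Forall₂ (fun g l => g (Wrec n y c) = ones l) gs ls)
    {k : ℕ} (hk : k < ls.length) : fldF gs k (Wrec n y c) = fld c (ls.take k).sum (ls[k]) := by
  have hlen : gs.length = ls.length := h.length_eq
  have hg : (gs.getD k fun _ => []) (Wrec n y c) = ones (ls[k]) := by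
    rw [List.getD_eq_getElem _ _ (by omega)]
    exact List.Forall₂.get h (by omega) hk |>.trans (by rfl)
  rw [fldF, Function.comp_apply, fanoutFn_apply, Function.comp_apply, fanoutFn_apply, WcF_W,
    sumF_apply_ones (List.forall₂_take k h), hg, dropFn_boolPair, takeFn_boolPair, fld]
  simp [ones]

/-- Value of the remainder brick. [folklore] -/
theorem restF_W {gs : List (List Bool → List Bool)} {ls : List ℕ} (h : List.Forall₂ (fun g l => g (Wrec n y c) = ones l) gs ls) :
    restF gs (Wrec n y c) = c.drop ls.sum := by
  rw [restF, Function.comp_apply, fanoutFn_apply, WcF_W, sumF_apply_ones h, dropFn_boolPair]; simp [ones]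

/-- `fldF gs k ∈ FP` for bricks in `FP`. [folklore] -/
theorem fldF_mem_FP {gs : List (List Bool → List Bool)} (h : ∀ g ∈ gs, g ∈ FP) (k : ℕ) : fldF gs k ∈ FP := by
  refine comp_mem_FP takeFn_mem_FP (fanoutFn_mem_FP ?_ (comp_mem_FP dropFn_mem_FP (fanoutFn_mem_FP
    (sumF_mem_FP fun g hg => h g (List.mem_of_mem_take hg)) WcF_mem_FP)))
  rw [List.getD_eq_getElem?_getD]
  cases hk : gs[k]? with
  | none => exact const_mem_FP _
  | some g => exact h g (List.mem_of_getElem? hk)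

/-- `restF gs ∈ FP`. [folklore] -/
theorem restF_mem_FP {gs : List (List Bool → List Bool)} (h : ∀ g ∈ gs, g ∈ FP) : restF gs ∈ FP :=
  comp_mem_FP dropFn_mem_FP (fanoutFn_mem_FP (sumF_mem_FP h) WcF_mem_FP)

end Fields

/-! ### The key fix-up (the conditioned key of Claim 4.6) -/

section Fixup

variable (n : ℕ)

/-- The number of leading zeros of `δ` (the pivot position; `|δ|` if `δ = 0…0`), as the machine finds it:
the leading ones of `δ ⊕ 1^{|δ|}`. [cite: HaitnerEtAl2020, Claim 4.6 (the inverter)] -/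
def lzStr (δ : List Bool) : ℕ := (splitOnes (List.zipWith xor δ (ones δ.length))).1

/-- Row `q` of an affine key for `{0,1}ⁿ → {0,1}^M`: bits `[q(n+1), q(n+1)+n]` (matrix row, then offset bit).
[cite: AroraBarakCC2009, Def. 8.14 (p. 185) with Exercise 8.4 (p. 204)] -/
def rowStr (κ₀ : List Bool) (q : ℕ) : List Bool := (κ₀.drop (q * (n + 1))).take (n + 1)

/-- The parity `⟨row_q, δ⟩` over `𝔽₂` (the `zipWith` stops at `|δ| = n`, so only matrix bits enter). [folklore] -/
def rowPar (κ₀ δ : List Bool) (q : ℕ) : Bool := decide (Odd (((rowStr n κ₀ q).zipWith (· && ·) δ).count true))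

/-- **The fixed-up row**: for `q < i` with `⟨row_q, δ⟩ = 1`, flip the bit of row `q` at the pivot of `δ`.
[cite: HaitnerEtAl2020, Claim 4.6 (the inverter: `g` uniform subject to `g(y)_{<i} = g(f x)_{<i}`)] -/
def fixRow (κ₀ δ : List Bool) (i q : ℕ) : List Bool :=
  if q < i ∧ rowPar n κ₀ δ q = true then
    (rowStr n κ₀ q).take (lzStr δ) ++ [!((rowStr n κ₀ q).getD (lzStr δ) false)] ++ (rowStr n κ₀ q).drop (lzStr δ + 1)
  else rowStr n κ₀ q

/-- **The fixed-up key**: all `M` rows. [cite: HaitnerEtAl2020, Claim 4.6] -/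
def fixupStr (κ₀ δ : List Bool) (i : ℕ) : List Bool := ccat (fun q => fixRow n κ₀ δ i q) (M n)

variable {n}

/-- `|rowStr| ≤ n + 1`. [folklore] -/
theorem length_rowStr_le (κ₀ : List Bool) (q : ℕ) : (rowStr n κ₀ q).length ≤ n + 1 := by
  rw [rowStr, List.length_take]; exact min_le_left _ _

/-- `|fixRow| = |rowStr|` (a flip inside the row keeps the length when the pivot is inside). [folklore] -/
theorem length_fixRow {κ₀ δ : List Bool} {i q : ℕ} (hp : lzStr δ < (rowStr n κ₀ q).length) :
    (fixRow n κ₀ δ i q).length = (rowStr n κ₀ q).length := by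
  unfold fixRow; split_ifs
  · simp only [List.length_append, List.length_take, List.length_singleton, List.length_drop]; omega
  · rfl

/-- `|fixRow| ≤ n + 1` always. [folklore] -/
theorem length_fixRow_le (κ₀ δ : List Bool) (i q : ℕ) : (fixRow n κ₀ δ i q).length ≤ n + 2 := by
  unfold fixRow; split_ifs
  · simp only [List.length_append, List.length_take, List.length_singleton, List.length_drop]
    have := length_rowStr_le (n := n) κ₀ q; omega
  · exact (length_rowStr_le _ _).trans (Nat.le_succ _)

/-! #### The fix-up brick. Context record `C = ⟨1ⁿ, ⟨κ₀, ⟨δ, 1ⁱ⟩⟩⟩`; pieces on `⟨C, 1^q⟩`. -/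

/-- `1ⁿ` of the context. [folklore] -/
noncomputable def CnF : List Bool → List Bool := nthF 0 ∘ fstF
/-- `κ₀` of the context. [folklore] -/
noncomputable def CkF : List Bool → List Bool := nthF 1 ∘ fstF
/-- `δ` of the context. [folklore] -/
noncomputable def CdF : List Bool → List Bool := nthF 2 ∘ fstF
/-- `1ⁱ` of the context. [folklore] -/
noncomputable def CiF : List Bool → List Bool := sndPow 2 ∘ fstF
/-- `1^q` (the round). [folklore] -/
noncomputable def CqF : List Bool → List Bool := sndF

/-- The piece record. [folklore] -/
def Crec (n : ℕ) (κ₀ δ : List Bool) (i q : ℕ) : List Bool :=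
  boolPair (boolPair (ones n) (boolPair κ₀ (boolPair δ (ones i)))) (ones q)

variable (κ₀ δ : List Bool) (i q : ℕ)

/-- Bookkeeping lemma (record accessors). [folklore] -/
@[simp] theorem CnF_C : CnF (Crec n κ₀ δ i q) = ones n := by simp [CnF, Crec]
/-- Bookkeeping lemma (record accessors). [folklore] -/
@[simp] theorem CkF_C : CkF (Crec n κ₀ δ i q) = κ₀ := by simp [CkF, Crec]
/-- Bookkeeping lemma (record accessors). [folklore] -/
@[simp] theorem CdF_C : CdF (Crec n κ₀ δ i q) = δ := by simp [CdF, Crec]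
/-- Bookkeeping lemma (record accessors). [folklore] -/
@[simp] theorem CiF_C : CiF (Crec n κ₀ δ i q) = ones i := by simp [CiF, Crec]
/-- Bookkeeping lemma (record accessors). [folklore] -/
@[simp] theorem CqF_C : CqF (Crec n κ₀ δ i q) = ones q := by simp [CqF, Crec]

/-- The pivot `1^{lz δ}`. [cite: HaitnerEtAl2020, Claim 4.6] -/
noncomputable def pivF : List Bool → List Bool := onesPrefixFn ∘ xorStrFn ∘ fanoutFn CdF (onesFn ∘ CdF)

/-- The row `row_q`. [folklore] -/
noncomputable def rowF : List Bool → List Bool :=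
  takeFn ∘ fanoutFn (List.cons true ∘ CnF) (dropFn ∘ fanoutFn (HashBricks.umulFn ∘ fanoutFn CqF (List.cons true ∘ CnF)) CkF)

/-- The condition `[q < i ∧ ⟨row_q, δ⟩ = 1]`. [cite: HaitnerEtAl2020, Claim 4.6] -/
noncomputable def condF : List Bool → List Bool :=
  andFn (ltLenF ∘ fanoutFn CqF CiF) (HashBricks.andParityFn ∘ fanoutFn rowF CdF)

/-- The flipped row. [cite: HaitnerEtAl2020, Claim 4.6] -/
noncomputable def flipF : List Bool → List Bool :=
  catF (catF (takeFn ∘ fanoutFn pivF rowF) (notFn (bitAtFn ∘ fanoutFn pivF rowF))) (dropFn ∘ fanoutFn (List.cons true ∘ pivF) rowF)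

/-- The piece: the fixed-up row `q`. [cite: HaitnerEtAl2020, Claim 4.6] -/
noncomputable def fixRowF : List Bool → List Bool := iteFn condF flipF rowF

/-- **The fix-up brick** on the context `⟨1ⁿ, ⟨κ₀, ⟨δ, 1ⁱ⟩⟩⟩`: the `M` fixed-up rows. [cite: HaitnerEtAl2020, Claim 4.6] -/
noncomputable def fixupP : List Bool → List Bool :=
  foldCat (Polynomial.X + 2) (polyOf E.M) fixRowF ∘ fanoutFn id (szF E.M)

variable {κ₀ δ i q}

/-- Value of the pivot brick. [folklore] -/
theorem pivF_C : pivF (Crec n κ₀ δ i q) = ones (lzStr δ) := by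
  rw [pivF, Function.comp_apply, Function.comp_apply, fanoutFn_apply, Function.comp_apply, CdF_C,
    xorStrFn_boolPair_eq_zipWith (by simp [onesFn, unaryEncodeNat_eq_replicate]), lzStr, onesPrefixFn]
  simp [onesFn, unaryEncodeNat_eq_replicate, ones]

/-- Value of the row brick. [folklore] -/
theorem rowF_C : rowF (Crec n κ₀ δ i q) = rowStr n κ₀ q := by
  rw [rowF]
  simp only [Function.comp_apply, fanoutFn_apply, CnF_C, CqF_C, CkF_C]
  rw [show true :: ones n = ones (n + 1) by simp [ones, List.replicate_succ], HashBricks.umulFn_boolPair, dropFn_boolPair,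
    takeFn_boolPair, rowStr]
  simp [ones]

/-- Value of the condition brick. [folklore] -/
theorem condF_C : condF (Crec n κ₀ δ i q) = [decide (q < i) && rowPar n κ₀ δ q] := by
  rw [condF, andFn_apply (b := decide (q < i)) (b' := rowPar n κ₀ δ q)]
  · rw [Function.comp_apply, fanoutFn_apply, CqF_C, CiF_C, ltLenF_boolPair]; simp [ones]
  · rw [Function.comp_apply, fanoutFn_apply, rowF_C, CdF_C, AffineProg.andParityFn_apply, fstF_boolPair, sndF_boolPair, rowPar]

/-- Value of the flip brick (pivot inside the row). [folklore] -/
theorem flipF_C (hp : lzStr δ < (rowStr n κ₀ q).length) :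
    flipF (Crec n κ₀ δ i q) =
      (rowStr n κ₀ q).take (lzStr δ) ++ [!((rowStr n κ₀ q).getD (lzStr δ) false)] ++ (rowStr n κ₀ q).drop (lzStr δ + 1) := by
  have hbit : (bitAtFn ∘ fanoutFn pivF rowF) (Crec n κ₀ δ i q) = [(rowStr n κ₀ q).getD (lzStr δ) false] := by
    rw [Function.comp_apply, fanoutFn_apply, pivF_C, rowF_C, bitAtFn_boolPair_of_lt _ _ (by simpa [ones] using hp)]
    simp only [ones, List.length_replicate, List.getD_eq_getElem?_getD, List.getElem?_eq_getElem hp, Option.getD_some]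
  rw [flipF, catF_apply, catF_apply, Function.comp_apply, fanoutFn_apply, pivF_C, rowF_C, takeFn_boolPair, notFn_apply hbit,
    Function.comp_apply, fanoutFn_apply, Function.comp_apply, pivF_C, rowF_C, dropFn_boolPair]
  simp [ones]

/-- **Value of the piece**: the fixed-up row (pivot inside the row, which holds whenever the row is full and
`lz δ ≤ n`). [cite: HaitnerEtAl2020, Claim 4.6] -/
theorem fixRowF_C (hp : lzStr δ < (rowStr n κ₀ q).length) : fixRowF (Crec n κ₀ δ i q) = fixRow n κ₀ δ i q := by
  rw [fixRowF, fixRow]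
  by_cases hq : q < i <;> cases hpar : rowPar n κ₀ δ q
  · rw [iteFn_apply_false (by rw [condF_C, hpar]; simp), rowF_C, if_neg (by simp)]
  · rw [iteFn_apply_true (by rw [condF_C, hpar]; simp [hq]), flipF_C hp, if_pos ⟨hq, rfl⟩]
  · rw [iteFn_apply_false (by rw [condF_C, hpar]; simp), rowF_C, if_neg (by simp)]
  · rw [iteFn_apply_false (by rw [condF_C, hpar]; simp [hq]), rowF_C, if_neg (by simp [hq])]

/-- `lz δ ≤ |δ|`. [folklore] -/
theorem lzStr_le (δ : List Bool) : lzStr δ ≤ δ.length := by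
  have h := length_onesPrefixFn_le (List.zipWith xor δ (ones δ.length))
  rw [onesPrefixFn, List.length_zipWith] at h
  simpa [ones, lzStr] using h.trans (min_le_left _ _)

/-- **`fixupP` computes `fixupStr`** on a full key (`|κ₀| ≥ M(n+1)`) and `|δ| = n`. [cite: HaitnerEtAl2020, Claim 4.6] -/
theorem fixupP_apply {κ₀ δ : List Bool} (hκ : lK n ≤ κ₀.length) (hδ : δ.length = n) (i : ℕ) :
    fixupP (boolPair (ones n) (boolPair κ₀ (boolPair δ (ones i)))) = fixupStr n κ₀ δ i := by
  have hrow : ∀ q, q < M n → (rowStr n κ₀ q).length = n + 1 := fun q hq => by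
    rw [rowStr, List.length_take, List.length_drop, min_eq_left]
    rw [lK] at hκ
    have : q * (n + 1) + (n + 1) ≤ M n * (n + 1) := by rw [← Nat.succ_mul]; exact Nat.mul_le_mul_right _ hq
    omega
  have hp : ∀ q, q < M n → lzStr δ < (rowStr n κ₀ q).length := fun q hq => by
    rw [hrow q hq]; have := lzStr_le δ; omega
  have hn : n ≤ (boolPair (ones n) (boolPair κ₀ (boolPair δ (ones i)))).length := by simp [ones]; omega
  rw [fixupP, Function.comp_apply, fanoutFn_apply, id, szF_boolPair]
  simp only [E.M_eval, if_pos]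
  rw [foldCat_apply]
  · rw [List.length_replicate, fixupStr]
    exact ccat_congr fun q hq => fixRowF_C (hp q hq)
  · rw [List.length_replicate]; exact eval_le_polyOf E.M hn
  · intro q hq
    rw [List.length_replicate] at hq
    rw [show boolPair (boolPair (ones n) (boolPair κ₀ (boolPair δ (ones i)))) (ones q) = Crec n κ₀ δ i q from rfl, fixRowF_C (hp q hq)]
    refine (length_fixRow_le _ _ _ _).trans ?_
    simp [ones]; omega

/-- `fixupP ∈ FP`. [cite: HaitnerEtAl2020, Claim 4.6 ("efficient")] -/
theorem fixupP_mem_FP : fixupP ∈ FP := by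
  have hn : CnF ∈ FP := comp_mem_FP (nthF_mem_FP 0) fstF_mem_FP
  have hk : CkF ∈ FP := comp_mem_FP (nthF_mem_FP 1) fstF_mem_FP
  have hd : CdF ∈ FP := comp_mem_FP (nthF_mem_FP 2) fstF_mem_FP
  have hi : CiF ∈ FP := comp_mem_FP (sndPow_mem_FP 2) fstF_mem_FP
  have hq : CqF ∈ FP := sndF_mem_FP
  have hpiv : pivF ∈ FP := comp_mem_FP onesPrefixFn_mem_FP (comp_mem_FP xorStrFn_mem_FP (fanoutFn_mem_FP hd (comp_mem_FP onesFn_mem_FP hd)))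
  have hrow : rowF ∈ FP := comp_mem_FP takeFn_mem_FP (fanoutFn_mem_FP (comp_mem_FP (cons_mem_FP true) hn)
    (comp_mem_FP dropFn_mem_FP (fanoutFn_mem_FP (comp_mem_FP HashBricks.umulFn_mem_FP (fanoutFn_mem_FP hq (comp_mem_FP (cons_mem_FP true) hn))) hk)))
  have hcond : condF ∈ FP := andFn_mem_FP (comp_mem_FP ltLenF_mem_FP (fanoutFn_mem_FP hq hi))
    (comp_mem_FP HashBricks.andParityFn_mem_FP (fanoutFn_mem_FP hrow hd))
  have hflip : flipF ∈ FP := catF_mem_FP (catF_mem_FP (comp_mem_FP takeFn_mem_FP (fanoutFn_mem_FP hpiv hrow))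
    (notFn_mem_FP (comp_mem_FP bitAtFn_mem_FP (fanoutFn_mem_FP hpiv hrow)))) (comp_mem_FP dropFn_mem_FP (fanoutFn_mem_FP (comp_mem_FP (cons_mem_FP true) hpiv) hrow))
  exact comp_mem_FP (foldCat_mem_FP _ _ (iteFn_mem_FP hcond hflip hrow)) (fanoutFn_mem_FP (PolyTimeComputable.id _) (szF_mem_FP _))

end Fixup

/-! ### Splicing a block into a concatenation of blocks -/

/-- Replace block `b` (of width `m`) of `l` by `Q`. [folklore] -/
def splice (m b : ℕ) (Q l : List Bool) : List Bool := l.take (b * m) ++ Q ++ l.drop ((b + 1) * m)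

/-- `|splice| = |l|` when `|Q| = m` and block `b` lies inside `l`. [folklore] -/
theorem length_splice {m b : ℕ} {Q l : List Bool} (hQ : Q.length = m) (hb : (b + 1) * m ≤ l.length) :
    (splice m b Q l).length = l.length := by
  simp only [splice, List.length_append, List.length_take, List.length_drop, hQ, Nat.succ_mul] at hb ⊢
  rw [min_eq_left (by omega)]; omega

/-- Cutting inside the first part of a concatenation. [folklore] -/
theorem take_drop_append_left {A B : List Bool} {off c : ℕ} (h : off + c ≤ A.length) :
    ((A ++ B).drop off).take c = (A.drop off).take c := by
  rw [List.drop_append, List.take_append, List.length_drop, Nat.sub_eq_zero_of_le (by omega : off ≤ A.length),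
    List.drop_zero, Nat.sub_eq_zero_of_le (by omega : c ≤ A.length - off), List.take_zero, List.append_nil]

/-- **Blocks of a splice**: block `b` is `Q`, every other block is unchanged. [folklore] -/
theorem splice_block {m b : ℕ} {Q l : List Bool} (hQ : Q.length = m) (hb : (b + 1) * m ≤ l.length) (i : ℕ) :
    ((splice m b Q l).drop (i * m)).take m = if i = b then Q else (l.drop (i * m)).take m := by
  have hb' : b * m + m ≤ l.length := by rw [Nat.succ_mul] at hb; exact hb
  have hP : (l.take (b * m)).length = b * m := by rw [List.length_take, min_eq_left (by omega)]
  have hPQ : (l.take (b * m) ++ Q).length = (b + 1) * m := by rw [List.length_append, hP, hQ, Nat.succ_mul]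
  rw [splice]
  rcases lt_trichotomy i b with hib | rfl | hib
  · -- inside the prefix
    have h1 : i * m + m ≤ b * m := by rw [← Nat.succ_mul]; exact Nat.mul_le_mul_right _ hib
    rw [if_neg hib.ne, take_drop_append_left (by rw [hPQ, Nat.succ_mul]; omega), take_drop_append_left (by rw [hP]; exact h1),
      List.drop_take, List.take_take, min_eq_left (by omega)]
  · -- the spliced block
    rw [if_pos rfl, List.append_assoc, List.drop_left' hP, List.take_left' hQ]
  · -- inside the suffix
    have h3 : (b + 1) * m ≤ i * m := Nat.mul_le_mul_right _ hib
    rw [if_neg hib.ne', List.drop_append, List.drop_of_length_le (by rw [hPQ]; exact h3), List.nil_append, hPQ, List.drop_drop]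
    congr 2
    omega

/-- **The code of an updated tuple** is the splice of the new component's code into its block. [folklore] -/
theorem _root_.Literature.Computability.Complexity.BitCodec.pi_enc_update {α : Type*} (c : BitCodec α) (t : ℕ)
    (w : Fin t → α) (b : Fin t) (a : α) :
    (c.pi t).enc (Function.update w b a) = splice c.len b (c.enc a) ((c.pi t).enc w) := by
  have hl : ((c.pi t).enc w).length = t * c.len := (c.pi t).length_enc w
  have hb : ((b : ℕ) + 1) * c.len ≤ ((c.pi t).enc w).length := by rw [hl]; exact Nat.mul_le_mul_right _ b.isLt
  rw [← ccat_of_blocks ((c.pi t).length_enc (Function.update w b a)),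
    ← ccat_of_blocks (show (splice c.len b (c.enc a) ((c.pi t).enc w)).length = t * c.len by rw [length_splice (c.length_enc a) hb, hl])]
  refine ccat_congr fun i hi => ?_
  rw [pi_enc_block c t _ ⟨i, hi⟩, splice_block (c.length_enc a) hb]
  by_cases hib : i = b
  · rw [if_pos hib, show (⟨i, hi⟩ : Fin t) = b from Fin.ext hib, Function.update_self]
  · rw [if_neg hib, Function.update_of_ne (fun h => hib (by rw [← h])), pi_enc_block c t w ⟨i, hi⟩]

/-! ### Splicing as a brick -/

section Splice

/-- `spliceP ⟨1ᵐ, ⟨1ᵇ, ⟨Q, l⟩⟩⟩ = splice m b Q l`. [folklore] -/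
noncomputable def spliceP : List Bool → List Bool :=
  catF (catF (takeFn ∘ fanoutFn (HashBricks.umulFn ∘ fanoutFn (nthF 1) (nthF 0)) (sndPow 2)) (nthF 2))
    (dropFn ∘ fanoutFn (HashBricks.umulFn ∘ fanoutFn (List.cons true ∘ nthF 1) (nthF 0)) (sndPow 2))

/-- Value of `spliceP`. [folklore] -/
theorem spliceP_apply (m b : ℕ) (Q l : List Bool) :
    spliceP (boolPair (ones m) (boolPair (ones b) (boolPair Q l))) = splice m b Q l := by
  rw [spliceP]
  simp only [catF_apply, Function.comp_apply, fanoutFn_apply, nthF_zero_boolPair, nthF_succ_boolPair, sndPow_succ_boolPair,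
    sndPow_zero_boolPair]
  rw [show true :: ones b = ones (b + 1) by simp [ones, List.replicate_succ], HashBricks.umulFn_boolPair, HashBricks.umulFn_boolPair,
    takeFn_boolPair, dropFn_boolPair, splice]
  simp [ones]

/-- `spliceP ∈ FP`. [folklore] -/
theorem spliceP_mem_FP : spliceP ∈ FP :=
  catF_mem_FP (catF_mem_FP (comp_mem_FP takeFn_mem_FP (fanoutFn_mem_FP
    (comp_mem_FP HashBricks.umulFn_mem_FP (fanoutFn_mem_FP (nthF_mem_FP 1) (nthF_mem_FP 0))) (sndPow_mem_FP 2))) (nthF_mem_FP 2))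
    (comp_mem_FP dropFn_mem_FP (fanoutFn_mem_FP (comp_mem_FP HashBricks.umulFn_mem_FP (fanoutFn_mem_FP (comp_mem_FP (cons_mem_FP true) (nthF_mem_FP 1)) (nthF_mem_FP 0))) (sndPow_mem_FP 2)))

end Splice

/-! ### The partial chain -/

section ChainUpto

/-- The initialisation for `r` rounds: `⟨X, 1ʳ⟩ ↦ ⟨X, ⟨bin r, ⟨1⁰, x ↾ N⟩⟩⟩`. [folklore] -/
noncomputable def chainInitRF : List Bool → List Bool :=
  fanoutFn fstF (fanoutFn (lenBinF ∘ sndF) (fanoutFn (fun _ => []) (takeFn ∘ fanoutFn (XszF E.N ∘ fstF) (XxF ∘ fstF))))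

/-- **The partial chain brick** `chainUptoP f ⟨X, 1ʳ⟩ = chainSt f n j kb x r` for `X = ⟨⟨1ⁿ, ⟨kb, x⟩⟩, 1ʲ⟩`.
[cite: HaitnerEtAl2020, Lemma 5.7 (the level-`r` state)] -/
noncomputable def chainUptoP (f : List Bool → List Bool) : List Bool → List Bool := sndPow 2 ∘ chainLoopF f ∘ chainInitRF

/-- Value of the initialisation. [folklore] -/
theorem chainInitRF_apply (n j : ℕ) (kb x : List Bool) (r : ℕ) :
    chainInitRF (boolPair (Xrec n j kb x) (ones r)) = Zrec n j kb x (encodeNat r) 0 (x.take (N n)) := by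
  simp only [chainInitRF, fanoutFn_apply, Function.comp_apply, fstF_boolPair, sndF_boolPair, lenBinF_apply, XszF_X, XxF_X,
    takeFn_boolPair, E.N_eval, if_pos]
  simp [Zrec, ones]

/-- **`chainUptoP f ⟨X, 1ʳ⟩ = chainSt f n j kb x r`** for `r ≤ R`, `|kb| ≥ K`, `j ≤ J`, `|x| = d`.
[cite: HaitnerEtAl2020, Lemma 5.7] -/
theorem chainUptoP_apply (f : List Bool → List Bool) {n j : ℕ} {kb x : List Bool} (hkb : K n ≤ kb.length) (hj : j < Jp1 n)
    (hx : x.length = d n) {r : ℕ} (hr : r ≤ R n) :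
    chainUptoP f (boolPair (Xrec n j kb x) (ones r)) = chainSt f n j kb x r := by
  have hR : r ≤ (polyOf E.R).eval (Xrec n j kb x).length :=
    hr.trans (eval_le_polyOf E.R (by simp [Xrec, ones]; omega))
  rw [chainUptoP, Function.comp_apply, Function.comp_apply, chainInitRF_apply, chainLoopF, Zrec, fstF_boolPair,
    iterate_loopStep _ _ _ _ _ hR, show x.take (N n) = chainSt f n j kb x 0 from rfl, loopModel_bodyF f hkb hj hx r 0 (by omega),
    Nat.zero_add, sndPow_succ_boolPair, sndPow_succ_boolPair, sndPow_zero_boolPair]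

/-- `chainUptoP f ∈ FP` for `f ∈ FP`. [cite: HaitnerEtAl2020, Lemma 5.7 with proof of Thm. 5.1 ("polynomial time")] -/
theorem chainUptoP_mem_FP {f : List Bool → List Bool} (hf : f ∈ FP) : chainUptoP f ∈ FP :=
  comp_mem_FP (sndPow_mem_FP 2) (comp_mem_FP (chainLoopF_mem_FP hf)
    (fanoutFn_mem_FP fstF_mem_FP (fanoutFn_mem_FP (comp_mem_FP lenBinF_mem_FP sndF_mem_FP) (fanoutFn_mem_FP (const_mem_FP _)
      (comp_mem_FP takeFn_mem_FP (fanoutFn_mem_FP (comp_mem_FP (XszF_mem_FP _) fstF_mem_FP) (comp_mem_FP XxF_mem_FP fstF_mem_FP)))))))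

end ChainUpto

end HHRVW

end Literature.Computability.Cryptography
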